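import Summits.Ventures.YMGap.RobustBall.StringTensionExplicit
import Literature.MathematicalPhysics.QuantumLattice.SU2HaarSmallBall
import HarnessLib

/-!
# Robust ball (Y2), area-law side — the STRONG-COUPLING LAW OF THE STRING TENSION, two-sided and explicit:
`σ(β_W) = log(1/β_W) + O(1)` for SU(2), certified at every `0 < β_W ≤ 2/3`

HONEST FRAMING: venture file of the cell `pub-ymgap` (QuantumFields programme), track ROBUST-BALL, seat rb-p2 (g4).  LATTICE statements
about the infinite-volume limit states (`infiniteVolumeLimitPoints`) of the SU(2) torus Wilson states (tree coupling `β_W/2`); `σ(μ)` is the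
tree's `stringTension μ χ₂` (it EXISTS at every `β > 0`, `WilsonStringTension.stringTension_le`).  WHAT IS NEW: the explicit FLOOR of
`StringTensionExplicit` (`σ ≥ log(2/(nβ_W))`) is joined with an explicit CEILING — rb-p2 g3's `σ ≤ −log u₀`,
`u₀ = β e^{−8(d−1)Nβ} V₀/(2(d−1)N)`, made numerical by the bound `V₀ = ∫_{SU(2)}(Re tr)² dHaar ≥ 49/4096` (from the tree's small-ball
estimate `le_haarProbability_su2_two_sub_trace_le`: `Haar{2 − Re tr U ≤ 1/4} ≥ 1/256`, and `(Re tr)² ≥ 49/16` there) — so that for SU(2) in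
`d = n + 1 ≥ 2` dimensions and EVERY infinite-volume limit state:
`log(1/β_W) + log(2/n) ≤ σ(μ) ≤ log(1/β_W) + log(32768 n/49) + 8nβ_W` on `0 < β_W ≤ 2/n`;
`d = 4`: `|σ(μ) − log(1/β_W)| ≤ log(98304/49) + 24β_W` (`≤ 7.61 + 24β_W`) on `(0, 2/3]` — Wilson's strong-coupling law
`σ ≈ log(1/β_W)` (= `log g²` up to constants) holds to leading order, uniformly over limit states, with certified constants.
WHAT IT IS NOT: the O(1) constants are door / one-link artefacts (true value: `σ = log(4/β_W) + O(β_W)` from the character expansion,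
not claimed); `V₀ = 1` exactly (Schur orthogonality) is not used — only `V₀ ≥ 49/4096`; nothing continuum / spectral / Clay.

References: K. Wilson, Phys. Rev. D 10 (1974) 2445 (σ = −log(g⁻²) + … at strong coupling); E. Seiler, LNP 159 (1982) §2;
M. Creutz, Phys. Rev. D 21 (1980) 2308 (for comparison only).
-/

noncomputable section

open MeasureTheory Filter Topology
open Literature.MathematicalPhysics.QuantumLattice
open Literature.MathematicalPhysics.QuantumFieldTheory hiding ZdEdge Site

namespace Summit.Ventures.YMGap.RobustBall

namespace StringTensionExplicit

variable {n : ℕ}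

/-! ### The character variance of SU(2) is bounded below explicitly -/

/-- **`V₀(SU(2)) ≥ 49/4096`**: `∫_{SU(2)} (Re tr U)² dHaar ≥ (7/4)² · Haar{2 − Re tr U ≤ 1/4} ≥ (49/16)(1/256)` (the tree's
`le_haarProbability_su2_two_sub_trace_le`).  (The exact value is `1` by Schur orthogonality; not needed here.) [folklore] -/
theorem charVariance_su2_ge : (49 / 4096 : ℝ) ≤ PlaquetteLowerBound.charVariance (fundamentalRep (Fin 2)) := by
  set G := Matrix.specialUnitaryGroup (Fin 2) ℂ
  set A : Set G := {U : G | 2 - ((U : Matrix (Fin 2) (Fin 2) ℂ).trace).re ≤ 1 / 4} with hA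
  have hρ : Continuous (fundamentalRep (Fin 2) : G → Matrix (Fin 2) (Fin 2) ℂ) := continuous_fundamentalRep (Fin 2)
  have hc : Continuous (PlaquetteLowerBound.reTr (fundamentalRep (Fin 2)) : G → ℝ) :=
    PlaquetteLowerBound.continuous_reTr _ hρ
  have hc2 : Continuous fun g : G => PlaquetteLowerBound.reTr (fundamentalRep (Fin 2)) g ^ 2 := hc.pow 2
  have hint : Integrable (fun g : G => PlaquetteLowerBound.reTr (fundamentalRep (Fin 2)) g ^ 2) (haarProbability G) :=
    hc2.integrable_of_hasCompactSupport (HasCompactSupport.of_compactSpace _)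
  have hAc : IsClosed A := by
    have : Continuous fun U : G => 2 - ((U : Matrix (Fin 2) (Fin 2) ℂ).trace).re := by
      have h1 : Continuous fun U : G => ((U : Matrix (Fin 2) (Fin 2) ℂ).trace).re := by
        have e : (PlaquetteLowerBound.reTr (fundamentalRep (Fin 2)) : G → ℝ) =
            fun U : G => ((U : Matrix (Fin 2) (Fin 2) ℂ).trace).re :=
          funext fun U => by simp only [PlaquetteLowerBound.reTr]; rw [fundamentalRep_apply]
        rw [← e]; exact hc
      exact continuous_const.sub h1
    exact isClosed_le this continuous_const
  have hAm : MeasurableSet A := hAc.measurableSet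
  -- Haar mass of `A`
  have hμA : (1 / 256 : ℝ) ≤ (haarProbability G).real A := by
    have h := le_haarProbability_su2_two_sub_trace_le (η := 1 / 4) (by norm_num) le_rfl
    have h' : ENNReal.ofReal ((1 / 4 : ℝ) ^ 2 / 16) ≤ haarProbability G A := h
    rw [measureReal_def, ← ENNReal.ofReal_le_iff_le_toReal (measure_ne_top _ _)]
    have e : ((1 / 4 : ℝ) ^ 2 / 16) = 1 / 256 := by norm_num
    rwa [e] at h'
  -- pointwise: `(49/16)·𝟙_A ≤ (Re tr)²`
  have hpt : ∀ g : G, A.indicator (fun _ => (49 / 16 : ℝ)) g ≤ PlaquetteLowerBound.reTr (fundamentalRep (Fin 2)) g ^ 2 := by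
    intro g
    by_cases hg : g ∈ A
    · rw [Set.indicator_of_mem hg]
      have hg' : 2 - ((g : Matrix (Fin 2) (Fin 2) ℂ).trace).re ≤ 1 / 4 := hg
      have htr : PlaquetteLowerBound.reTr (fundamentalRep (Fin 2)) g = ((g : Matrix (Fin 2) (Fin 2) ℂ).trace).re := by
        simp only [PlaquetteLowerBound.reTr]; rw [fundamentalRep_apply]
      rw [htr]
      nlinarith
    · rw [Set.indicator_of_notMem hg]; positivity
  have hind : Integrable (A.indicator fun _ : G => (49 / 16 : ℝ)) (haarProbability G) :=
    (integrable_const _).indicator hAm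
  have hmono := integral_mono hind hint hpt
  rw [integral_indicator hAm, setIntegral_const, smul_eq_mul] at hmono
  unfold PlaquetteLowerBound.charVariance
  linarith [mul_le_mul_of_nonneg_right hμA (by norm_num : (0 : ℝ) ≤ 49 / 16)]

/-! ### The explicit ceiling and the two-sided law -/

/-- **EXPLICIT STRING-TENSION CEILING, SU(2), dimension `n + 1 ≥ 2`**: for every `β_W > 0` and every infinite-volume limit state
`μ` of the torus Wilson states at tree coupling `β_W/2`: `σ(μ) ≤ log(32768 n/(49 β_W)) + 8 n β_W`
(rb-p2 g3's `σ ≤ −log W(1,1) ≤ −log u₀` with `V₀ ≥ 49/4096`). [folklore] -/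
theorem su2_stringTension_le_log (hn : 1 ≤ n) {βW : ℝ} (hβ : 0 < βW) {μ : Measure (LGConfig (n + 1) (SUN 2))}
    (hμ : haveI : NeZero (n + 1) := ⟨by omega⟩; μ ∈ infiniteVolumeLimitPoints (fundamentalRep (Fin 2)) (βW / 2)) :
    haveI : NeZero (n + 1) := ⟨by omega⟩
    stringTension μ (fun g => normalisedCharacter 2 (fundamentalRep (Fin 2) g)) ≤
      Real.log (32768 * n / (49 * βW)) + 8 * n * βW := by
  haveI : NeZero (n + 1) := ⟨by omega⟩
  have hρ := TorusAreaLaw.isSpecialUnitaryModel_fundamentalRep 2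
  obtain ⟨-, -, hle, hu⟩ := WilsonStringTension.stringTension_le (d := n + 1) (fundamentalRep (Fin 2)) hρ le_rfl
    (by omega) (by positivity : 0 < βW / 2) hμ
  have hV := charVariance_su2_ge
  have hnr : (0 : ℝ) < n := by exact_mod_cast (show 0 < n by omega)
  have hd : ((n + 1 : ℕ) : ℝ) - 1 = n := by push_cast; ring
  rw [hd] at hu
  -- `u₀(V₀) ≥ u₀(49/4096) > 0`, so `−log u₀(V₀) ≤ −log u₀(49/4096)`
  set E : ℝ := βW / 2 * Real.exp (-(8 * (n : ℝ) * (2 : ℕ) * (βW / 2))) with hE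
  have hE0 : 0 < E := by positivity
  have hden : (0 : ℝ) < 2 * (n : ℝ) * (2 : ℕ) := by positivity
  have hlow : E * (49 / 4096) / (2 * (n : ℝ) * (2 : ℕ)) ≤
      E * PlaquetteLowerBound.charVariance (fundamentalRep (Fin 2)) / (2 * (n : ℝ) * (2 : ℕ)) :=
    div_le_div_of_nonneg_right (mul_le_mul_of_nonneg_left hV hE0.le) hden.le
  have hpos : 0 < E * (49 / 4096) / (2 * (n : ℝ) * (2 : ℕ)) := by positivity
  have hlog : -Real.log (E * PlaquetteLowerBound.charVariance (fundamentalRep (Fin 2)) / (2 * (n : ℝ) * (2 : ℕ))) ≤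
      -Real.log (E * (49 / 4096) / (2 * (n : ℝ) * (2 : ℕ))) :=
    neg_le_neg (Real.log_le_log hpos hlow)
  have hval : -Real.log (E * (49 / 4096) / (2 * (n : ℝ) * (2 : ℕ))) = Real.log (32768 * n / (49 * βW)) + 8 * n * βW := by
    have e1 : E * (49 / 4096) / (2 * (n : ℝ) * (2 : ℕ)) = (49 * βW / (32768 * n)) * Real.exp (-(8 * n * βW)) := by
      rw [hE]; push_cast; ring_nf
    rw [e1, Real.log_mul (by positivity) (Real.exp_pos _).ne', Real.log_exp]
    have e2 : Real.log (49 * βW / (32768 * n)) = -Real.log (32768 * n / (49 * βW)) := by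
      rw [← Real.log_inv, inv_div]
    rw [e2]; ring
  linarith

/-- ★★ **THE STRONG-COUPLING LAW OF THE STRING TENSION, TWO-SIDED** (SU(2), dimension `n + 1 ≥ 2`, `0 < β_W ≤ 2/n`): for EVERY
infinite-volume limit state `μ` of the torus Wilson states at tree coupling `β_W/2`,
`log(1/β_W) + log(2/n) ≤ σ(μ) ≤ log(1/β_W) + log(32768 n/49) + 8 n β_W` — i.e. `σ(β_W) = log(1/β_W) + O(1)` with certified constants.
[folklore] -/
theorem su2_stringTension_two_sided (hn : 1 ≤ n) {βW : ℝ} (hβ : 0 < βW) (hβ1 : (n : ℝ) * βW ≤ 2)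
    {μ : Measure (LGConfig (n + 1) (SUN 2))}
    (hμ : haveI : NeZero (n + 1) := ⟨by omega⟩; μ ∈ infiniteVolumeLimitPoints (fundamentalRep (Fin 2)) (βW / 2)) :
    haveI : NeZero (n + 1) := ⟨by omega⟩
    Real.log (1 / βW) + Real.log (2 / n) ≤ stringTension μ (fun g => normalisedCharacter 2 (fundamentalRep (Fin 2) g)) ∧
      stringTension μ (fun g => normalisedCharacter 2 (fundamentalRep (Fin 2) g)) ≤
        Real.log (1 / βW) + Real.log (32768 * n / 49) + 8 * n * βW := by
  haveI : NeZero (n + 1) := ⟨by omega⟩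
  have hnr : (0 : ℝ) < n := by exact_mod_cast (show 0 < n by omega)
  obtain ⟨-, hlow⟩ := su2_stringTension_ge_log hn hβ hβ1 hμ
  have hup := su2_stringTension_le_log hn hβ hμ
  have e1 : Real.log (2 / ((n : ℝ) * βW)) = Real.log (1 / βW) + Real.log (2 / n) := by
    rw [← Real.log_mul (by positivity) (by positivity)]; congr 1; field_simp
  have e2 : Real.log (32768 * n / (49 * βW)) = Real.log (1 / βW) + Real.log (32768 * n / 49) := by
    rw [← Real.log_mul (by positivity) (by positivity)]; congr 1; field_simp
  rw [e1] at hlow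
  rw [e2] at hup
  exact ⟨hlow, by linarith⟩

/-- ★★ **SU(2), `d = 4`: `|σ(μ) − log(1/β_W)| ≤ log(98304/49) + 24 β_W` for every infinite-volume limit state at every
`0 < β_W ≤ 2/3`** (`log(98304/49) ≤ 7.61`): the string tension follows Wilson's strong-coupling law `log(1/β_W)` up to a certified
bounded error, uniformly over limit states. [folklore] -/
theorem su2_stringTension_sub_log_abs_le_dim4 {βW : ℝ} (hβ : 0 < βW) (hβ1 : βW ≤ 2 / 3)
    {μ : Measure (LGConfig 4 (SUN 2))} (hμ : μ ∈ infiniteVolumeLimitPoints (fundamentalRep (Fin 2)) (βW / 2)) :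
    |stringTension μ (fun g => normalisedCharacter 2 (fundamentalRep (Fin 2) g)) - Real.log (1 / βW)| ≤
      Real.log (98304 / 49) + 24 * βW := by
  obtain ⟨hlow, hup⟩ := su2_stringTension_two_sided (n := 3) (by norm_num) hβ (by push_cast; linarith) hμ
  push_cast at hlow hup
  have h23 : -(Real.log (98304 / 49)) ≤ Real.log (2 / 3) := by
    have h1 : Real.log (2 / 3) = -Real.log (3 / 2) := by rw [← Real.log_inv]; norm_num
    rw [h1, neg_le_neg_iff]
    exact Real.log_le_log (by norm_num) (by norm_num)
  have e3 : Real.log (32768 * 3 / 49) = Real.log (98304 / 49) := by norm_num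
  rw [e3] at hup
  rw [abs_le]
  constructor <;> nlinarith

/-- ★ **The leading-order law as a ratio** (SU(2), `d = 4`, `0 < β_W ≤ 1/3`, so that `log(1/β_W) ≥ log 3 > 0`):
`|σ(μ)/log(1/β_W) − 1| ≤ (log(98304/49) + 24β_W)/log(1/β_W)` — the right-hand side tends to `0` as `β_W → 0`. [folklore] -/
theorem su2_stringTension_div_log_sub_one_abs_le_dim4 {βW : ℝ} (hβ : 0 < βW) (hβ1 : βW ≤ 1 / 3)
    {μ : Measure (LGConfig 4 (SUN 2))} (hμ : μ ∈ infiniteVolumeLimitPoints (fundamentalRep (Fin 2)) (βW / 2)) :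
    |stringTension μ (fun g => normalisedCharacter 2 (fundamentalRep (Fin 2) g)) / Real.log (1 / βW) - 1| ≤
      (Real.log (98304 / 49) + 24 * βW) / Real.log (1 / βW) := by
  have hL : 0 < Real.log (1 / βW) := Real.log_pos (by rw [lt_div_iff₀ hβ]; linarith)
  have h := su2_stringTension_sub_log_abs_le_dim4 hβ (by linarith) hμ
  rw [show stringTension μ (fun g => normalisedCharacter 2 (fundamentalRep (Fin 2) g)) / Real.log (1 / βW) - 1 =
      (stringTension μ (fun g => normalisedCharacter 2 (fundamentalRep (Fin 2) g)) - Real.log (1 / βW)) / Real.log (1 / βW) by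
    field_simp]
  rw [abs_div, abs_of_pos hL]
  exact div_le_div_of_nonneg_right h hL.le

end StringTensionExplicit

end Summit.Ventures.YMGap.RobustBall
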